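import Mathlib
import HarnessLib
import Summits.Parity.GeneralizedHardyLittlewood.Theses.LeeYangFibres
import Summits.Parity.GeneralizedHardyLittlewood.Theorems.LeeYangFibresModelHyperbolicity

/-!
# Route `LeeYangFibres`, crux `FibreHyperbolicity` (stmt-Parity-14108): vocabulary of the line "model transfer"

Route-posited objects and STATEMENTS (D-0016 `<Route><Crux>Defs` file) shared by the registered stubs of the
skeleton `Cruxes/FibreHyperbolicity/Lines/SketchIdeator1.lean` (as reshaped by the line lead
`prover-line-stmt-Parity-14108-0`) and by the file that will compose them. Nothing is asserted: every
`def … : Prop` below is a statement (a registered stub type or a hypothesis bundle), consumed only as the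
type of a stub theorem or as an explicit hypothesis; the one theorem, `fibreExpand`, is proved.

The line: `FibreHyperbolicity ⇐ CellModelLaw t` (joint rough Ω-cells follow the independent model to relative
accuracy — Alladi-in-a-progression at `t = 1`, parity-free and provable; a ghost-free Hardy–Littlewood law at
`t ≥ 2`, open-problem strength) `+` simple real zeros of the model polynomial `Σ_{m<u} I_{m+1}(u) X^m`
(PROVED: `WindowChainTransport.stub_simpleZeros`) `+` a Hurwitz/IVT perturbation lemma `+` fibre bookkeeping.

Objects: `jointCell` (the crux's cell, verbatim), `fibre` (the crux's fibre sum, verbatim), `FHAt t` (the crux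
at fixed `t`; `crux_iff`). Statements: `CellModelLaw t`, `PerturbLemma`, `CoeffBound`, `FibreExpansion`
(proved here: `fibreExpand`), `APCellAsymptotic` (Ω-cells of rough integers in a fixed residue class,
`(X, Y)`-format, little-o), `SegmentLawOne` (the `t = 1` law in arithmetic coordinates).

References: Alladi 1982 (Quart. J. Math. Oxford 33) [Alladi1982]; Tenenbaum III.6 [Tenenbaum2015];
Green–Tao 2010 §1 [GreenTao2010] (normalisations `β_∞`, `𝔖`).
-/

noncomputable section

namespace Summit.Parity.GeneralizedHardyLittlewood.Cruxes.FibreHyperbolicity.ModelTransfer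

open scoped BigOperators Classical
open Finset Polynomial
open Literature.NumberTheory.Sieve
open Summit.Parity.GeneralizedHardyLittlewood.Theses.LeeYangFibres (FibreHyperbolicity)
open Summit.Parity.GeneralizedHardyLittlewood.Cruxes.ModelHyperbolicity.WindowChainTransport (cellDensity)

/-! ## Objects -/

/-- The joint rough Ω-cell of the crux: `C_j = #{n ∈ K ∩ ℤ : N^{1/u} < P⁻(ψ_k(n)), Ω(ψ_k(n)) = j_k ∀ k}`
(verbatim the filtered cardinality inside `FibreHyperbolicity`). -/
def jointCell (t N u : ℕ) (Ψ : Fin t → AffLinForm 1) (K : Set (Fin 1 → ℝ)) (j : Fin t → ℕ) : ℕ :=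
  ((latticeBox 1 N).filter (fun n => realPoint n ∈ K ∧
      ∀ k, (N : ℝ) ^ ((1 : ℝ) / u) < (Nat.minFac ((Ψ k).eval n).toNat : ℝ) ∧
        ArithmeticFunction.cardFactors ((Ψ k).eval n).toNat = j k)).card

/-- The fibre polynomial of the crux in coordinate `i` at frozen fugacities `w`, evaluated at `ζ`:
`Σ_{j ∈ [1,u]^t} C_j ∏_k (ζ if k = i else w_k)^{j_k}` (verbatim the sum inside `FibreHyperbolicity`). -/
def fibre (t N u : ℕ) (Ψ : Fin t → AffLinForm 1) (K : Set (Fin 1 → ℝ)) (i : Fin t) (w : Fin t → ℝ)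
    (ζ : ℂ) : ℂ :=
  ∑ j ∈ Fintype.piFinset (fun _ : Fin t => Finset.Icc 1 u),
    ((jointCell t N u Ψ K j : ℕ) : ℂ) * ∏ k, (if k = i then ζ else ((w k : ℝ) : ℂ)) ^ (j k)

/-- `FibreHyperbolicity` at a fixed number of forms `t` (the crux is `∀ t ≥ 1, FHAt t`, see `crux_iff`). -/
def FHAt (t : ℕ) : Prop :=
  ∀ (L u₀ : ℕ) (η : ℝ), 0 < η → ∃ u : ℕ, u₀ ≤ u ∧ 2 ≤ u ∧ ∃ N₀ : ℕ, ∀ N : ℕ, N₀ ≤ N →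
    ∀ Ψ : Fin t → AffLinForm 1, IsNondegenerateSystem Ψ → affLinSize Ψ N ≤ L →
    ∀ K : Set (Fin 1 → ℝ), Convex ℝ K → K ⊆ realBox 1 N →
    η * (N : ℝ) ≤ archFactor Ψ K * singularProduct Ψ →
    ∀ i : Fin t, ∀ w : Fin t → ℝ, (∀ k, 0 < w k ∧ w k ≤ 1) →
    ∀ ζ : ℂ, fibre t N u Ψ K i w ζ = 0 → ζ.im = 0

/-- The crux, factored through `FHAt` (pure binder shuffling). -/
theorem crux_iff : FibreHyperbolicity ↔ ∀ t : ℕ, 1 ≤ t → FHAt t :=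
  ⟨fun h t ht L u₀ η hη => h t L u₀ ht η hη, fun h t L u₀ ht η hη => h t ht L u₀ η hη⟩

/-! ## Statements (types of the registered stubs) -/

/-- **The cell model law for `t` forms** (relative to the independent-anatomy model, ghost-free): for all
`L`, `u ≥ 2`, `η, ε > 0` and `N ≥ N₀`, every admissible `(Ψ, K)` (non-degenerate, `‖Ψ‖_N ≤ L`, `K` convex in
`[-N,N]`, `ηN ≤ β_∞ 𝔖`) has a normaliser `Λ > 0` with
`|C_j − Λ ∏_k I_{j_k}(u)| ≤ ε Λ ∏_{k : j_k < u} I_{j_k}(u)` for every `j ∈ [1,u]^t`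
(`I_m(u) = cellDensity (m-1) u`; `I_u(u) = 0`, so top cells are merely SMALL: `C_j ≤ ε Λ ∏_{j_k<u} I_{j_k}`).
At `t = 1` this is Alladi's theorem in a progression segment (parity-free); at `t ≥ 2` it is a ghost-free
Hardy–Littlewood law for joint rough cells (open-problem strength). -/
def CellModelLaw (t : ℕ) : Prop :=
  ∀ (L u : ℕ), 2 ≤ u → ∀ η : ℝ, 0 < η → ∀ ε : ℝ, 0 < ε → ∃ N₀ : ℕ, ∀ N : ℕ, N₀ ≤ N →
    ∀ Ψ : Fin t → AffLinForm 1, IsNondegenerateSystem Ψ → affLinSize Ψ N ≤ L →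
    ∀ K : Set (Fin 1 → ℝ), Convex ℝ K → K ⊆ realBox 1 N →
    η * (N : ℝ) ≤ archFactor Ψ K * singularProduct Ψ →
    ∃ Λ : ℝ, 0 < Λ ∧ ∀ j ∈ Fintype.piFinset (fun _ : Fin t => Finset.Icc 1 u),
      |(jointCell t N u Ψ K j : ℝ) - Λ * ∏ k, cellDensity (j k - 1) u| ≤
        ε * Λ * ∏ k ∈ Finset.univ.filter (fun k => j k < u), cellDensity (j k - 1) u

/-- **Perturbation lemma** (Hurwitz/IVT form): a nonzero real polynomial `Q` with `deg Q` distinct real roots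
admits `ε > 0` such that every real `q` of degree `≤ deg Q + 1` whose coefficients are `ε`-close to those of
`Q` has only real complex roots. -/
def PerturbLemma : Prop :=
  ∀ Q : ℝ[X], Q ≠ 0 → Q.natDegree ≤ Q.roots.toFinset.card →
    ∃ ε : ℝ, 0 < ε ∧ ∀ q : ℝ[X], q.natDegree ≤ Q.natDegree + 1 →
      (∀ n : ℕ, |q.coeff n - Q.coeff n| ≤ ε) →
      ∀ z : ℂ, (q.map (algebraMap ℝ ℂ)).eval z = 0 → z.im = 0

/-- **Fibre coefficient bound** (abstract arrays): if `|C_j − Λ ∏_k I(j_k)| ≤ ε Λ ∏_{k : j_k < u} I(j_k)` on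
the box `[1,u]^t`, with `I ≥ 0`, `I 1 = 1`, `I u = 0`, fugacities `w ∈ (0,1]^t`, then the `m`-th fibre
coefficient `p_m = Σ_{j_i = m} C_j ∏_{k ≠ i} w_k^{j_k}` satisfies
`|p_m − Λ' I(m)| ≤ 2^{t-1} ε Λ' (I(m) + [m = u])`, `Λ' = Λ ∏_{k≠i} Σ_{n=1}^u I(n) w_k^n`. -/
def CoeffBound : Prop :=
  ∀ (t u : ℕ), 2 ≤ u → ∀ (i : Fin t) (C : (Fin t → ℕ) → ℝ) (I : ℕ → ℝ) (Λ ε : ℝ) (w : Fin t → ℝ),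
    (∀ n, 0 ≤ I n) → I 1 = 1 → I u = 0 → 0 ≤ Λ → 0 ≤ ε → (∀ k, 0 < w k ∧ w k ≤ 1) →
    (∀ j ∈ Fintype.piFinset (fun _ : Fin t => Finset.Icc 1 u),
      |C j - Λ * ∏ k, I (j k)| ≤ ε * Λ * ∏ k ∈ Finset.univ.filter (fun k => j k < u), I (j k)) →
    ∀ m ∈ Finset.Icc 1 u,
      |(∑ j ∈ (Fintype.piFinset (fun _ : Fin t => Finset.Icc 1 u)).filter (fun j => j i = m),
          C j * ∏ k ∈ Finset.univ.erase i, w k ^ (j k)) -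
        (Λ * ∏ k ∈ Finset.univ.erase i, ∑ n ∈ Finset.Icc 1 u, I n * w k ^ n) * I m| ≤
      2 ^ (t - 1) * ε * (Λ * ∏ k ∈ Finset.univ.erase i, ∑ n ∈ Finset.Icc 1 u, I n * w k ^ n) *
        (I m + if m = u then 1 else 0)

/-- **Fibre expansion**: the crux's fibre sum regrouped by the free exponent `m = j_i`:
`Σ_j C_j ∏_k (ζ | w_k)^{j_k} = Σ_{m=1}^u p_m ζ^m` with real `p_m = Σ_{j_i = m} C_j ∏_{k≠i} w_k^{j_k}`. -/
def FibreExpansion : Prop :=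
  ∀ (t u : ℕ) (i : Fin t) (C : (Fin t → ℕ) → ℕ) (w : Fin t → ℝ) (ζ : ℂ),
    (∑ j ∈ Fintype.piFinset (fun _ : Fin t => Finset.Icc 1 u),
        ((C j : ℕ) : ℂ) * ∏ k, (if k = i then ζ else ((w k : ℝ) : ℂ)) ^ (j k)) =
      ∑ m ∈ Finset.Icc 1 u,
        ((∑ j ∈ (Fintype.piFinset (fun _ : Fin t => Finset.Icc 1 u)).filter (fun j => j i = m),
            (C j : ℝ) * ∏ k ∈ Finset.univ.erase i, w k ^ (j k) : ℝ) : ℂ) * ζ ^ m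

/-- **Alladi's Ω-cell asymptotic in a fixed residue class** (`(X, Y)`-format of the tree's `CellRate`, little-o
form): for `q ≥ 1`, every `i, k` and `ε > 0` there is `X₀` such that, uniformly in `r` prime to `q` and in
`2 ≤ Y ≤ X ≤ Y^k`, `X ≥ X₀`:
`|#{n ≤ X : n ≡ r (q), P⁻(n) ≥ ⌈Y⌉, Ω(n) = i+1} − (X I_{i+1}(log X/log Y)/log X − [i=0] Y/log Y)/φ(q)| ≤ ε X/log Y`.
(Differences between reduced classes by induction on `i` over the Ω-refined Buchstab identity in classes —
tree: `RoughAP.card_filter_roughIcc_eq_add_sum`, `RoughAP.abs_card_filter_sub_le_step_of`,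
`RoughAP.exists_forall_abs_primeCountingMod_sub_le` — plus the class-total `CellRate`.) Parity-free. -/
def APCellAsymptotic : Prop :=
  ∀ q : ℕ, 1 ≤ q → ∀ i k : ℕ, ∀ ε : ℝ, 0 < ε → ∃ X₀ : ℝ, ∀ r : ℕ, r.Coprime q →
    ∀ X Y : ℝ, 2 ≤ Y → Y ≤ X → X₀ ≤ X → Real.log X ≤ k * Real.log Y →
      |((((Finset.Icc 1 ⌊X⌋₊).filter (fun n => n ≡ r [MOD q] ∧ ⌈Y⌉₊ ≤ Nat.minFac n ∧
            ArithmeticFunction.cardFactors n = i + 1)).card : ℕ) : ℝ) -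
          (X * cellDensity i (Real.log X / Real.log Y) / Real.log X -
              if i = 0 then Y / Real.log Y else 0) / (Nat.totient q : ℝ)| ≤
        ε * X / Real.log Y

/-- **Segment law for one progression** (the `t = 1` cell law in arithmetic coordinates): Ω-cells of the
`N^{1/u}`-rough integers of a residue class `r mod q` (`q ≤ L`) in a segment `(M₁, M₂] ⊆ (0, LN]` of length
`≥ ηN` are `Λ₀ I_j(u) (1 ± ε)` for `j < u` and `≤ ε Λ₀` for `j = u`, `Λ₀ = (M₂ − M₁)/(φ(q) log N)`,
uniformly (`N ≥ N₀(L, u, η, ε)`). Parity-free (from `APCellAsymptotic` + continuity of the densities). -/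
def SegmentLawOne : Prop :=
  ∀ (L u : ℕ), 2 ≤ u → ∀ η : ℝ, 0 < η → ∀ ε : ℝ, 0 < ε → ∃ N₀ : ℕ, ∀ N : ℕ, N₀ ≤ N →
    ∀ q r : ℕ, 1 ≤ q → q ≤ L → r.Coprime q → ∀ M₁ M₂ : ℕ, M₁ ≤ M₂ → (M₂ : ℝ) ≤ L * N →
    η * N ≤ (M₂ : ℝ) - M₁ → ∀ j : ℕ, 1 ≤ j → j ≤ u →
      |((((Finset.Ioc M₁ M₂).filter (fun m => m ≡ r [MOD q] ∧
            (N : ℝ) ^ ((1 : ℝ) / u) < (Nat.minFac m : ℝ) ∧ ArithmeticFunction.cardFactors m = j)).card : ℕ) : ℝ) -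
          ((M₂ : ℝ) - M₁) / ((Nat.totient q : ℝ) * Real.log N) * cellDensity (j - 1) u| ≤
        ε * (((M₂ : ℝ) - M₁) / ((Nat.totient q : ℝ) * Real.log N)) * (if j < u then cellDensity (j - 1) u else 1)

/-! ## The one proved statement -/

/-- The fibre expansion identity `FibreExpansion` (proved; pure algebra: split off the `i`-th factor,
`Finset.sum_fiberwise_of_maps_to`). -/
theorem fibreExpand : FibreExpansion := by
  intro t u i C w ζ
  classical
  set box := Fintype.piFinset (fun _ : Fin t => Finset.Icc 1 u) with hbox
  have hprod : ∀ j : Fin t → ℕ, (∏ k, (if k = i then ζ else ((w k : ℝ) : ℂ)) ^ (j k)) =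
      ζ ^ (j i) * ∏ k ∈ Finset.univ.erase i, ((w k : ℝ) : ℂ) ^ (j k) := by
    intro j
    rw [← Finset.mul_prod_erase Finset.univ _ (Finset.mem_univ i), if_pos rfl]
    congr 1
    exact Finset.prod_congr rfl fun k hk => by rw [if_neg (Finset.ne_of_mem_erase hk)]
  simp_rw [hprod]
  have hcast : ∀ m : ℕ, ((∑ j ∈ box.filter (fun j => j i = m),
      (C j : ℝ) * ∏ k ∈ Finset.univ.erase i, w k ^ (j k) : ℝ) : ℂ) =
      ∑ j ∈ box.filter (fun j => j i = m),
        ((C j : ℕ) : ℂ) * ∏ k ∈ Finset.univ.erase i, ((w k : ℝ) : ℂ) ^ (j k) := by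
    intro m
    push_cast
    rfl
  simp_rw [hcast, Finset.sum_mul]
  have hmaps : ∀ j ∈ box, j i ∈ Finset.Icc 1 u := fun j hj => Fintype.mem_piFinset.mp hj i
  rw [← Finset.sum_fiberwise_of_maps_to hmaps]
  refine Finset.sum_congr rfl fun m _ => Finset.sum_congr rfl fun j hj => ?_
  rw [(Finset.mem_filter.mp hj).2]
  ring

end Summit.Parity.GeneralizedHardyLittlewood.Cruxes.FibreHyperbolicity.ModelTransfer

end
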